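import Summits.HubbardSuperconductivity.HubbardSuperconductivity.Theorems.AnisotropyChordTransferFibre3TwoHoleBSCapacity
import Summits.HubbardSuperconductivity.HubbardSuperconductivity.Theorems.AnisotropyChordTransferFibre3EtaEffLower
import Summits.HubbardSuperconductivity.HubbardSuperconductivity.Theorems.AnisotropyChordTransferFibre3LamPart
import Summits.HubbardSuperconductivity.HubbardSuperconductivity.Theorems.AnisotropyChordTransferFibre3ShellMajorant

/-!
# Route `AnisotropyChord` / H0 rotor rung: the HOLE₂(.75) TAIL PER PAIR with every PROVED input inserted — capacity bound, rate-lemma error, and the one residual analytic obligation (periodisation)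

Tenth file of PROP BS (memo ROTOR-THEORY-21 §317(d), §320–§322, §331; theory seat `hubbard-h0-rotor-theory-1`).  The robust
certificate `dualCert_of_skeleton_capUpper` (…Fibre3TwoHoleBSCapacity) needs, per pair class: a model kernel `A∞`, an entrywise
error `δ ≥ |A_L − A∞|`, a capacity upper bound `Λ_up ≥ Λ̃_L`, and a margin inequality.  Two of these are now TREE THEOREMS and are
inserted here at `g = ¾ε₁` (walk units: `A_L = 2·aKer L (3ε₁/2)`, `Λ̃_L = capT L (¾ε₁) = 2·Gres L (3ε₁/2) 0`):
* ★ `capT_le_harmonic` (`2 ≤ L`): `Λ̃_L ≤ 4·H_{⌊L/2⌋}` — from p1 g24's `Gres_zero_zero_le_ratio` (factor 4 at λ = 3ε₁/2) and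
  `Gres_zero_zero_le_harmonic` (`G̃₀(0) ≤ H_{L/2}/2`); crude constant, right order (the tail tolerates any `Λ_up = o(L²/ln L)`);
* ★ `kerMat_sub_model_le` (`4 ≤ L`, `0 ≤ g`, `2g < 2ε₁`): `|A_L(p,q) − A_m(p,q)| ≤ 2·S(r_pq, L; 2g) + |2·aKer L 0 (r_pq) − A_m(p,q)|`
  with `S = RateLemma.shellSum` — the λ-HALF of the kernel error is the PROVED rate lemma (p2 g0: `lamPartShellBound_holds`,
  `shellMajorant_holds`: `S ≤ |r|²(11.71 ln L + 5.9)/L²`), the second term is the PERIODISATION error at `λ = 0`;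
* ★★ `dualCert_threeQuarter_of_tail` (`8 ≤ L`): `DualCert L (¾ε₁) z₁ z₂` from (i) a bound `S_max` on the rate-lemma majorants over
  the window, (ii) a PERIODISATION bound `|2·aKer L 0 (pt p − pt q) − A∞ p q| ≤ δ_per` — THE REMAINING ANALYTIC INPUT (memo §322 /
  PartN37 `TorusKernelQuadraticLaw`-type, not yet a tree theorem), (iii) `Λ_up ≥ 4H_{L/2}` with `Λ_up·s ≠ 1`, and (iv) the margin
  inequality `(2S_max + δ_per)(Σ|Eŵ|)² ≤ wᵀ·twoHoleP A∞ Λ_up·w` (finite algebra on the skeleton; `E = smInv A∞ Λ_up`).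
With `twoHoleGap_of_dualCert_reps` (…TwoHoleBSReps) this is the complete shape of HOLE₂(.75) ∀L ≥ L₀ in Lean modulo (ii) and the
skeleton data.
Prover seat `hubbard-h0-rotor-p2` g2; helper for stmt-HubbardSuperconductivity-19089 (`--supports`, helper class).
WHAT THIS IS NOT: nothing here proves superconductivity in the Hubbard model; the rotor TARGET as originally worded stays
FALSE (g15 verdict).  A conditional reduction of ONE input (HOLE₂) of ONE conditional reduction (rung 19089); the periodisation
bound and the skeleton margins remain hypotheses.  Mathlib + tree imports only; no sorry, no axioms.
-/

set_option linter.dupNamespace false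

noncomputable section

open scoped BigOperators
open Complex Finset

namespace Summit.HubbardSuperconductivity.HubbardSuperconductivity.Theorems.AnisotropyChord.Transfer.Fibre3

namespace TwoHoleBS

variable (L : ℕ) [NeZero L]

/-! ## The PROVED inputs of the HOLE₂ tail at `g = ¾ε₁`: capacity upper bound and the λ-half of the kernel error; the residual obligation -/

/-- ★ CAPACITY UPPER BOUND at the HOLE₂(.75) point: `Λ̃_L = G̃_{¾ε₁}(0) ≤ 4·H_{⌊L/2⌋}` (`L ≥ 2`), from p1 g24's
`Gres_zero_zero_le_ratio` (`G̃_λ(0) ≤ G̃₀(0)·2ε₁/(2ε₁−λ)`, factor `4` at `λ = 3ε₁/2`) and `Gres_zero_zero_le_harmonic`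
(`G̃₀(0) ≤ H_{L/2}/2`).  Crude in the constant (`4 ln L` vs the true `(1/2π) ln L`) but of the right order — enough for the tail,
whose margin degrades only like `1/Λ_up` against an error `δ_L = O(ln L / L²)`. [folklore] -/
theorem capT_le_harmonic (hL : 2 ≤ L) : capT L (3 / 4 * eps1 L) ≤ 4 * (harmonic (L / 2) : ℝ) := by
  have he := RateLemma.eps1_pos_of_two_le L hL
  have h1 := Gres_zero_zero_le_ratio L hL (lam2 := 2 * (3 / 4 * eps1 L)) (by positivity) (by linarith)
  have h2 := Gres_zero_zero_le_harmonic L hL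
  have hr : 2 * eps1 L / (2 * eps1 L - 2 * (3 / 4 * eps1 L)) = 4 := by
    rw [div_eq_iff (by linarith)]; ring
  rw [hr] at h1
  unfold capT
  linarith

/-- ★ KERNEL ERROR SPLIT (λ-half PROVED): for `4 ≤ L`, `0 ≤ g`, `2g < 2ε₁` and any model kernel `A_m`,
`|A_L(p,q) − A_m(p,q)| ≤ 2·S(r_{pq}, L; 2g) + |2·aKer L 0 (r_{pq}) − A_m(p,q)|`, `r_{pq} = pt p − pt q`, where `S = shellSum` is the
rate-lemma majorant (`lamPartShellBound_holds`: `0 ≤ aKer λ − aKer 0 ≤ S`; `shellMajorant_holds`: `S ≤ |r|²(11.71 ln L + 5.9)/L²` on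
integer coordinates, `8 ≤ L`, `λ ≤ 3ε₁/2`).  The second term — the PERIODISATION error of the `λ = 0` torus kernel against the model
(memo 21 §322, `TorusKernelQuadraticLaw`-type) — is the one remaining analytic input of the HOLE₂ tail. [folklore] -/
theorem kerMat_sub_model_le (hL : 4 ≤ L) {g : ℝ} (hg0 : 0 ≤ g) (hg : 2 * g < 2 * eps1 L) (z₁ z₂ : Tor L)
    (Am : Matrix (Fin 5 ⊕ Fin 5) (Fin 5 ⊕ Fin 5) ℝ) (p q : Fin 5 ⊕ Fin 5) :
    |kerMat L g z₁ z₂ p q - Am p q|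
      ≤ 2 * RateLemma.shellSum L (2 * g) (bsPt L z₁ z₂ p - bsPt L z₁ z₂ q)
        + |2 * aKer L 0 (bsPt L z₁ z₂ p - bsPt L z₁ z₂ q) - Am p q| := by
  set r := bsPt L z₁ z₂ p - bsPt L z₁ z₂ q with hr
  have hb := RateLemma.lamPartShellBound_holds L hL (2 * g) (by linarith) hg r
  unfold RateLemma.lamPart at hb
  have hk : kerMat L g z₁ z₂ p q = 2 * (aKer L (2 * g) r - aKer L 0 r) + 2 * aKer L 0 r := by
    simp only [kerMat, Matrix.of_apply, hr]; ring
  rw [hk, add_sub_assoc]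
  refine (abs_add_le _ _).trans ?_
  have h2 : |2 * (aKer L (2 * g) r - aKer L 0 r)| ≤ 2 * RateLemma.shellSum L (2 * g) r := by
    rw [abs_of_nonneg (by linarith [hb.1])]
    linarith [hb.2]
  linarith

/-- ★★ **THE HOLE₂(.75) TAIL, per pair, with every PROVED input inserted** (`8 ≤ L`): given a symmetric invertible model
kernel `A∞` (the ℤ² skeleton of the pair class), numbers `δ_per`, `Λ_up` with
(i) `|2·aKer L 0 (pt p − pt q) − A∞ p q| ≤ δ_per` for all slots (PERIODISATION — the open analytic input),
(ii) `4·H_{L/2} ≤ Λ_up`, `Λ_up·s ≠ 1` (capacity; (ii) is discharged by `capT_le_harmonic`),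
(iii) the margin inequality `(2·S_max + δ_per)·(Σ_p|(Eŵ)_p|)² ≤ wᵀ·twoHoleP A∞ Λ_up·w` for all real boundary `w`, where
`S_max` bounds the rate-lemma majorants `shellSum L (3ε₁/2) (pt p − pt q)` (`shellMajorant_holds` gives `|r|²(11.71 ln L+5.9)/L²`),
then `DualCert L (¾ε₁) z₁ z₂`. [folklore] -/
theorem dualCert_threeQuarter_of_tail (hL : 8 ≤ L) (z₁ z₂ : Tor L) (Ainf : Matrix (Fin 5 ⊕ Fin 5) (Fin 5 ⊕ Fin 5) ℝ)
    (hs : Ainf.IsSymm) (hA : IsUnit Ainf.det) (Smax δper Λup : ℝ)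
    (hS : ∀ p q : Fin 5 ⊕ Fin 5, RateLemma.shellSum L (2 * (3 / 4 * eps1 L)) (bsPt L z₁ z₂ p - bsPt L z₁ z₂ q) ≤ Smax)
    (hper : ∀ p q : Fin 5 ⊕ Fin 5, |2 * aKer L 0 (bsPt L z₁ z₂ p - bsPt L z₁ z₂ q) - Ainf p q| ≤ δper)
    (hcap : 4 * (harmonic (L / 2) : ℝ) ≤ Λup) (hΛ : Λup * TwoChannel.svec2 Ainf - 1 ≠ 0)
    (hpos : ∀ w : Fin 4 ⊕ Fin 4 → ℝ,
      (2 * Smax + δper) * (∑ p : Fin 5 ⊕ Fin 5, |(smInv Ainf Λup).mulVec (pad w) p|) ^ 2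
        ≤ dotProduct w ((TwoChannel.twoHoleP Ainf Λup).mulVec w)) :
    DualCert L (3 / 4 * eps1 L) z₁ z₂ := by
  have hL2 : 2 ≤ L := by omega
  have hL4 : 4 ≤ L := by omega
  have he := RateLemma.eps1_pos_of_two_le L hL2
  refine dualCert_of_skeleton_capUpper L (3 / 4 * eps1 L) z₁ z₂ Ainf hs hA Λup hΛ
    ((capT_le_harmonic L hL2).trans hcap) (2 * Smax + δper) (fun p q => ?_) hpos
  have h := kerMat_sub_model_le L hL4 (g := 3 / 4 * eps1 L) (by positivity) (by linarith) z₁ z₂ Ainf p q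
  have h1 := hS p q
  have h2 := hper p q
  linarith

end TwoHoleBS

end Summit.HubbardSuperconductivity.HubbardSuperconductivity.Theorems.AnisotropyChord.Transfer.Fibre3

end
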